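import Literature.Geometry.Kaehler.ComplexTorusEffectiveClassesIsogeny
import HarnessLib

/-!
# Bauer 1998, Prop. 3.1 and Thm. 4.2 (the exclusion of repeated factors): for an abelian variety
# `X ≠ 0` the semigroup of effective classes `N(X × X)` is not finitely generated, and the nef cone
# `Nef(X × X)` is not a finitely generated cone

Layer `Literature/Geometry/Kaehler`, namespace `Literature.Geometry.Kaehler.ComplexTorus`; lane
`lit-hodgefound`, seat p07 (generation 44), programme «THE NEF CONE OF AN ABELIAN VARIETY», file 52 of the
seat lineage; sequel of `ComplexTorusNefConePolyhedralSimple` (file 50: Prop. 2.2, the simple case) and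
`ComplexTorusEffectiveClassesIsogeny` (file 51: Lemma 4.1, isogeny invariance). Theorems only (no definition,
no named fact, no instance, no notation; net debt `0`).

THE SOURCE (Th. Bauer, *On the cone of curves of an abelian variety*, Amer. J. Math. 120 (1998), §3–§4;
held arXiv alg-geom/9712019, pp. 4–5), VERBATIM. **Proposition 3.1.** "Let `X` be an abelian variety with
`NS(X) ≅ ℤ`. Then `N(X × X)` is not finitely generated." ("To simplify the proof, we only consider abelian
varieties of Picard number `1` for now, as the general case will follow with no effort from the proof of the
theorem in Sect. 4.") The proof uses the line bundles `L₁ = pr₁^*M`, `L₂ = pr₂^*M`, `L₃ = μ^*M` (`μ` the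
addition map) and "the line bundles `B_m = (1-m)L₁ + (m²-m)L₂ + mL₃`", which are nef because `B_m`
"corresponds to the endomorphism `β_m = (1-m)α₁ + (m²-m)α₂ + mα₃`" (`α₁(x,y) = (x,0)`, `α₂(x,y) = (0,y)`,
`α₃(x,y) = (x+y,x+y)`) with "`β_m² = (m²+1)β_m`, so that `β_m | im β_m` is just multiplication by
`m²+1`". **Theorem 4.2** ("The semi-group `N(X)` is finitely generated if and only if `NS(Xᵢ) ≅ ℤ` and
`nᵢ = 1` for `1 ≤ i ≤ r`"), whose proof ends: "if we had `nᵢ > 1` for some `i`, i.e. if a multiple factor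
`Xᵢ` appeared in the product decomposition of `X`, then `N(Xᵢ × Xᵢ)` would be finitely generated, which
however is impossible according to Proposition 3.1."

THIS FILE proves, for EVERY complex abelian variety `X = E/Φ(ℤ^ι) ≠ 0` (the case of the Theorem in which
`X × X ~ ∏ Xᵢ^{2nᵢ}` has only repeated factors), that `N(X × X)` is not finitely generated — indeed that the
semi-positive classes of `NS(X × X)` do not even lie in any finitely generated convex cone of semi-positive
`(1,1)`-forms — with Bauer's classes `B_m` and the following DIRECT mechanism in place of the boundedness
statement `(*)` of the printed proof (which needs the Seesaw principle): with `M` a polarisation of `X` and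
`h = H_M`, the hermitian form of `B_m = (1-m)L₁ + (m²-m)L₂ + mL₃` is `H_{B_m}(x, y) = h(x + my)`
(`apply_I_smul_self_bauerClass`: this is the identity "`β_m² = (m²+1)β_m`", i.e. `(m²+1)B_m = β_m^*(L₁ + L₂)`), so
`B_m` is a non-zero semi-positive class of `NS(X × X)` whose hermitian form vanishes exactly on the graph
`K_m = {x + my = 0}` of `-m`. If all `B_m` lay in the cone `Σ ℝ≥0·gⱼ` of finitely many semi-positive
`(1,1)`-forms `g₁, …, g_k`, each `B_m` would be a combination of those `gⱼ` that vanish on `K_m` (§2), one of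
them non-zero; by pigeonhole one non-zero `gⱼ` vanishes on `K_m` and `K_{m'}` for `m ≠ m'`, hence on
`K_m + K_{m'} = E × E` (§1), so `gⱼ = 0` — contradiction.

## Contents

* §1 the planes `K_m`: `fst_add_smul_snd_decomposition` (`K_m + K_{m'} = E × E` for `m ≠ m'`),
  **`eq_zero_of_semipos_of_forall_graph_isotropic`** (a semi-positive `(1,1)`-form on `E × E` isotropic on two
  distinct graphs `K_m`, `K_{m'}` is `0`).
* §2 `mem_span_nnreal_sep_of_forall_apply_I_smul_self_eq_zero` (an element of a cone of semi-positive forms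
  that is isotropic on a set `W` lies in the cone of the generators isotropic on `W`).
* §3 Bauer's classes: `apply_I_smul_self_bauerClass` (`H_{B_m}(x,y) = H_M(x + my)`), their membership in
  `NS(X × X)`, semi-positivity, non-vanishing, and the isotropic graph `K_m`.
* §4 **`not_forall_bauerClass_mem_span_nnreal`** (no finitely generated cone of semi-positive `(1,1)`-forms
  contains all `B_m`), **`IsAbelianVariety.not_exists_finset_forall_semipos_mem_span_nnreal_prod`**,
  **`IsAbelianVariety.not_exists_finset_addSubmonoidClosure_eq_prod`** (PROP. 3.1, for every abelian variety
  `X ≠ 0`: `N(X × X)` is not finitely generated), `IsAbelianVariety.not_exists_finset_span_nnreal_eq_prod`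
  (`Nef(X × X)` is not rational polyhedral), and with Lemma 4.1 (file 51)
  **`IsIsogenous.not_exists_finset_addSubmonoidClosure_eq_of_prod`** (THM. 4.2, exclusion of repeated factors:
  no torus isogenous to `X × X` has finitely generated `N`).

## References

* [Bauer1998ConeOfCurves] Th. Bauer, *On the cone of curves of an abelian variety*, Amer. J. Math. 120 (1998)
  997–1006, §3 Prop. 3.1 and its proof (the classes `B_m`, the endomorphisms `α₁, α₂, α₃, β_m`), §4 Thm. 4.2
  (held: arXiv alg-geom/9712019, pp. 4–5).
* [Rosoff1981] J. A. Rosoff, *The monoid of effective divisor classes of a complex torus*, Lecture Notes in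
  Math. 862, Springer 1981, 208–231 (statement (2) of Bauer's introduction: `N(E₁ × E₂)` for elliptic curves).
* [Lange2023AbelianVarietiesComplex] H. Lange, *Abelian Varieties over the Complex Numbers*, Springer 2023,
  §2.1.1 Cor. 2.1.4 (`f^*` of a Néron–Severi class), §5.3 (products).
-/

noncomputable section

open scoped Manifold ComplexOrder NNReal
open Complex Set Function Module Filter Topology

universe u

namespace Literature.Geometry.Kaehler

namespace ComplexTorus

/-! ### §1 The graphs `K_m = {(x, y) | x + my = 0}`: two of them span `E × E`; a semi-positive form
isotropic on two of them vanishes -/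

section Graphs

variable {E : Type*} [NormedAddCommGroup E] [NormedSpace ℂ E]

/-- **`K_m + K_{m'} = E × E` for `m ≠ m'`**: every `(x, y)` is `(-m y₁, y₁) + (-m' y₂, y₂)` with
`y₂ = -(m' - m)⁻¹(x + my)`, `y₁ = y - y₂`. [folklore] -/
private theorem fst_add_smul_snd_decomposition {m m' : ℝ} (hmm' : m ≠ m') (x y : E) :
    ∃ y₁ y₂ : E, y₁ + y₂ = y ∧ -(m • y₁) + -(m' • y₂) = x := by
  have hd : m' - m ≠ 0 := sub_ne_zero.2 (Ne.symm hmm')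
  set z : E := (m' - m)⁻¹ • (x + m • y) with hz
  refine ⟨y + z, -z, by abel, ?_⟩
  have h1 : -(m • (y + z)) + -(m' • -z) = -(m • y) + (m' - m) • z := by
    rw [smul_add, smul_neg, neg_neg, sub_smul]
    abel
  rw [h1, hz, smul_smul, mul_inv_cancel₀ hd, one_smul]
  abel

/-- **A positive semi-definite `(1,1)`-form on `E × E` whose hermitian form vanishes on two distinct graphs
`K_m = {(-my, y)}`, `K_{m'}` is `0`**: isotropic vectors of a semi-positive form lie in its radical
(`apply_eq_zero_of_self_eq_zero`), the radical is a subspace, and `K_m + K_{m'} = E × E`. (The planes `K_m` are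
the kernels `ker β_m` of Bauer's endomorphisms `β_m`.) [cite: Bauer1998ConeOfCurves, §3 Prop. 3.1 (proof: the endomorphisms `β_m`)] -/
theorem eq_zero_of_semipos_of_forall_graph_isotropic {g : (E × E) [⋀^Fin 2]→L[ℝ] ℝ}
    (h11 : ∀ u v : E × E, g ![I • u, I • v] = g ![u, v]) (hpsd : ∀ v : E × E, 0 ≤ g ![I • v, v])
    {m m' : ℝ} (hmm' : m ≠ m') (hm : ∀ y : E, g ![I • ((-(m • y), y) : E × E), (-(m • y), y)] = 0)
    (hm' : ∀ y : E, g ![I • ((-(m' • y), y) : E × E), (-(m' • y), y)] = 0) : g = 0 := by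
  -- the isotropic graphs lie in the radical
  have hrad : ∀ y : E, ∀ w : E × E, g ![((-(m • y), y) : E × E), w] = 0 := fun y w ↦
    apply_eq_zero_of_self_eq_zero h11 hpsd (hm y) w
  have hrad' : ∀ y : E, ∀ w : E × E, g ![((-(m' • y), y) : E × E), w] = 0 := fun y w ↦
    apply_eq_zero_of_self_eq_zero h11 hpsd (hm' y) w
  have hall : ∀ v w : E × E, g ![v, w] = 0 := by
    rintro ⟨x, y⟩ w
    obtain ⟨y₁, y₂, hy, hx⟩ := fst_add_smul_snd_decomposition hmm' x y
    have hv : ((x, y) : E × E) = ((-(m • y₁), y₁) : E × E) + ((-(m' • y₂), y₂) : E × E) := by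
      rw [Prod.mk_add_mk, hx, hy]
    rw [hv, twoForm_add_left, hrad, hrad', add_zero]
  ext u
  have hu : u = ![u 0, u 1] := by
    funext i
    fin_cases i <;> rfl
  rw [hu, ContinuousAlternatingMap.coe_zero, Pi.zero_apply]
  exact hall _ _

end Graphs

/-! ### §2 Isotropic directions are inherited by the generators with positive coefficient -/

section ConeIsotropic

variable {E : Type*} [NormedAddCommGroup E] [NormedSpace ℂ E]

/-- **In a cone of semi-positive forms, an element isotropic on `W` is a combination of the generators
isotropic on `W`**: if `θ = Σ cⱼ gⱼ` (`cⱼ ≥ 0`, `gⱼ` semi-positive) and `H_θ(v, v) = 0` for all `v ∈ W`, then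
`H_{gⱼ}(v, v) = 0` on `W` whenever `cⱼ > 0`, so `θ ∈ Σ_{gⱼ isotropic on W} ℝ≥0·gⱼ`. [folklore] -/
private theorem mem_span_nnreal_sep_of_forall_apply_I_smul_self_eq_zero {G : Set (E [⋀^Fin 2]→L[ℝ] ℝ)}
    (hG : ∀ g ∈ G, ∀ v : E, 0 ≤ g ![I • v, v]) {θ : E [⋀^Fin 2]→L[ℝ] ℝ} (hθ : θ ∈ Submodule.span ℝ≥0 G)
    {W : Set E} (hW : ∀ v ∈ W, θ ![I • v, v] = 0) :
    θ ∈ Submodule.span ℝ≥0 {g | g ∈ G ∧ ∀ v ∈ W, g ![I • v, v] = 0} := by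
  suffices h : (∀ v : E, 0 ≤ θ ![I • v, v]) ∧
      ((∀ v ∈ W, θ ![I • v, v] = 0) → θ ∈ Submodule.span ℝ≥0 {g | g ∈ G ∧ ∀ v ∈ W, g ![I • v, v] = 0}) from
    h.2 hW
  clear hW
  induction hθ using Submodule.span_induction with
  | mem g hg => exact ⟨hG g hg, fun h ↦ Submodule.subset_span ⟨hg, h⟩⟩
  | zero =>
    exact ⟨fun v ↦ by rw [ContinuousAlternatingMap.coe_zero, Pi.zero_apply], fun _ ↦ Submodule.zero_mem _⟩
  | add x y _ _ ihx ihy =>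
    refine ⟨fun v ↦ ?_, fun h ↦ ?_⟩
    · rw [ContinuousAlternatingMap.add_apply]
      exact add_nonneg (ihx.1 v) (ihy.1 v)
    · have hx : ∀ v ∈ W, x ![I • v, v] = 0 := fun v hv ↦ by
        have h' := h v hv
        rw [ContinuousAlternatingMap.add_apply] at h'
        linarith [ihx.1 v, ihy.1 v]
      have hy : ∀ v ∈ W, y ![I • v, v] = 0 := fun v hv ↦ by
        have h' := h v hv
        rw [ContinuousAlternatingMap.add_apply] at h'
        linarith [ihx.1 v, ihy.1 v]
      exact Submodule.add_mem _ (ihx.2 hx) (ihy.2 hy)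
  | smul c x _ ih =>
    refine ⟨fun v ↦ ?_, fun h ↦ ?_⟩
    · rw [NNReal.smul_def, ContinuousAlternatingMap.smul_apply, smul_eq_mul]
      exact mul_nonneg c.2 (ih.1 v)
    · by_cases hc : c = 0
      · rw [hc, zero_smul]
        exact Submodule.zero_mem _
      · refine Submodule.smul_mem _ c (ih.2 fun v hv ↦ ?_)
        have h' := h v hv
        rw [NNReal.smul_def, ContinuousAlternatingMap.smul_apply, smul_eq_mul] at h'
        rcases mul_eq_zero.1 h' with h0 | h0
        · exact absurd (NNReal.coe_eq_zero.1 h0) hc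
        · exact h0

/-- **A non-zero element of a cone of semi-positive forms which is isotropic on `W` forces a NON-ZERO
generator isotropic on `W`.** [folklore] -/
private theorem exists_ne_zero_forall_apply_I_smul_self_eq_zero_of_mem_span_nnreal {G : Set (E [⋀^Fin 2]→L[ℝ] ℝ)}
    (hG : ∀ g ∈ G, ∀ v : E, 0 ≤ g ![I • v, v]) {θ : E [⋀^Fin 2]→L[ℝ] ℝ} (hθ : θ ∈ Submodule.span ℝ≥0 G)
    (hθ0 : θ ≠ 0) {W : Set E} (hW : ∀ v ∈ W, θ ![I • v, v] = 0) :
    ∃ g ∈ G, g ≠ 0 ∧ ∀ v ∈ W, g ![I • v, v] = 0 := by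
  have hmem := mem_span_nnreal_sep_of_forall_apply_I_smul_self_eq_zero hG hθ hW
  by_contra hne
  push Not at hne
  have hbot : Submodule.span ℝ≥0 {g | g ∈ G ∧ ∀ v ∈ W, g ![I • v, v] = 0} = ⊥ :=
    Submodule.span_eq_bot.2 fun g hg ↦ by
      by_contra hg0
      obtain ⟨v, hv, hv0⟩ := hne g hg.1 hg0
      exact hv0 (hg.2 v hv)
  rw [hbot, Submodule.mem_bot] at hmem
  exact hθ0 hmem

end ConeIsotropic

/-! ### §3 Bauer's classes `B_m = (1-m) pr₁^*M + (m²-m) pr₂^*M + m μ^*M` on `X × X`: hermitian form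
`H_M(x + my)`, semi-positive, non-zero, isotropic exactly along the graph `K_m` -/

section BauerClasses

variable {E : Type*} [NormedAddCommGroup E] [NormedSpace ℂ E]

/-- **`H_{B_m}(x, y) = H_M(x + my)`** for
`B_m = (1-m)·M∘pr₁ + (m²-m)·M∘pr₂ + m·M∘(pr₁+pr₂)` — Bauer's "`β_m² = (m²+1)β_m`, so that `β_m | im β_m` is
just multiplication by `m²+1`" (`(m²+1)B_m = β_m^*(L₁+L₂)` and `β_m(x,y) = (x+my)(1,m)`), checked by
bilinear expansion. [cite: Bauer1998ConeOfCurves, §3 Prop. 3.1 (proof: "`β_m² = (m²+1)β_m`")] -/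
theorem apply_I_smul_self_bauerClass (M : E [⋀^Fin 2]→L[ℝ] ℝ) (m : ℝ) (v : E × E) :
    (((1 - m) • M.compContinuousLinearMap (ContinuousLinearMap.fst ℝ E E) +
        (m ^ 2 - m) • M.compContinuousLinearMap (ContinuousLinearMap.snd ℝ E E) +
        m • M.compContinuousLinearMap (ContinuousLinearMap.fst ℝ E E + ContinuousLinearMap.snd ℝ E E)))
      ![I • v, v] = M ![I • (v.1 + m • v.2), v.1 + m • v.2] := by
  obtain ⟨x, y⟩ := v
  simp only [ContinuousAlternatingMap.add_apply, ContinuousAlternatingMap.smul_apply,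
    ContinuousAlternatingMap.compContinuousLinearMap_apply, smul_eq_mul]
  have h1 : (⇑(ContinuousLinearMap.fst ℝ E E) ∘ ![I • ((x, y) : E × E), (x, y)]) = ![I • x, x] := by
    funext i
    fin_cases i <;> rfl
  have h2 : (⇑(ContinuousLinearMap.snd ℝ E E) ∘ ![I • ((x, y) : E × E), (x, y)]) = ![I • y, y] := by
    funext i
    fin_cases i <;> rfl
  have h3 : (⇑(ContinuousLinearMap.fst ℝ E E + ContinuousLinearMap.snd ℝ E E) ∘ ![I • ((x, y) : E × E), (x, y)]) =
      ![I • x + I • y, x + y] := by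
    funext i
    fin_cases i <;> rfl
  have hI : I • (x + m • y) = I • x + m • I • y := by rw [smul_add, smul_comm]
  rw [h1, h2, h3, hI]
  simp only [twoForm_add_left, twoForm_add_right, twoForm_smul_left, twoForm_smul_right]
  ring

variable {ι : Type*} [Fintype ι] (Φ : (ι → ℝ) ≃L[ℝ] E)

omit [Fintype ι] in
/-- `pr₁^*η ∈ NS(X × X)` for `η ∈ NS(X)`. [cite: Lange2023AbelianVarietiesComplex, §2.1.1 Cor. 2.1.4] -/
private theorem isNSForm_comp_fst₅₂ [Fintype ι] {η : E [⋀^Fin 2]→L[ℝ] ℝ} (hη : IsNSForm Φ η) :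
    IsNSForm (prodPeriod Φ Φ) (η.compContinuousLinearMap (ContinuousLinearMap.fst ℝ E E)) := by
  refine ⟨fun u v ↦ ?_, fun m n ↦ ?_⟩
  · rw [ContinuousAlternatingMap.compContinuousLinearMap_apply, ContinuousAlternatingMap.compContinuousLinearMap_apply]
    have h : (⇑(ContinuousLinearMap.fst ℝ E E) ∘ ![I • u, I • v]) = ![I • u.1, I • v.1] := by
      funext i
      fin_cases i <;> rfl
    have h' : (⇑(ContinuousLinearMap.fst ℝ E E) ∘ ![u, v]) = ![u.1, v.1] := by
      funext i
      fin_cases i <;> rfl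
    rw [h, h', hη.type_one_one]
  · obtain ⟨k, hk⟩ := hη.integral (fun i ↦ m (Sum.inl i)) (fun i ↦ n (Sum.inl i))
    refine ⟨k, ?_⟩
    rw [ContinuousAlternatingMap.compContinuousLinearMap_apply, latticeVec_prodPeriod, latticeVec_prodPeriod]
    have h : (⇑(ContinuousLinearMap.fst ℝ E E) ∘
        ![((latticeVec Φ fun i ↦ m (Sum.inl i), latticeVec Φ fun j ↦ m (Sum.inr j)) : E × E),
          (latticeVec Φ fun i ↦ n (Sum.inl i), latticeVec Φ fun j ↦ n (Sum.inr j))]) =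
        ![latticeVec Φ fun i ↦ m (Sum.inl i), latticeVec Φ fun i ↦ n (Sum.inl i)] := by
      funext i
      fin_cases i <;> rfl
    rw [h, hk]

omit [Fintype ι] in
/-- `μ^*η ∈ NS(X × X)` for `η ∈ NS(X)` (`μ = pr₁ + pr₂` the addition map). [cite: Lange2023AbelianVarietiesComplex, §2.1.1 Cor. 2.1.4] -/
private theorem isNSForm_comp_fst_add_snd₅₂ [Fintype ι] {η : E [⋀^Fin 2]→L[ℝ] ℝ} (hη : IsNSForm Φ η) :
    IsNSForm (prodPeriod Φ Φ)
      (η.compContinuousLinearMap (ContinuousLinearMap.fst ℝ E E + ContinuousLinearMap.snd ℝ E E)) := by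
  refine ⟨fun u v ↦ ?_, fun m n ↦ ?_⟩
  · rw [ContinuousAlternatingMap.compContinuousLinearMap_apply, ContinuousAlternatingMap.compContinuousLinearMap_apply]
    have h : (⇑(ContinuousLinearMap.fst ℝ E E + ContinuousLinearMap.snd ℝ E E) ∘ ![I • u, I • v]) =
        ![I • (u.1 + u.2), I • (v.1 + v.2)] := by
      funext i
      fin_cases i
      · simp [smul_add]
      · simp [smul_add]
    have h' : (⇑(ContinuousLinearMap.fst ℝ E E + ContinuousLinearMap.snd ℝ E E) ∘ ![u, v]) = ![u.1 + u.2, v.1 + v.2] := by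
      funext i
      fin_cases i <;> rfl
    rw [h, h', hη.type_one_one]
  · obtain ⟨k, hk⟩ := hη.integral ((fun i ↦ m (Sum.inl i)) + fun i ↦ m (Sum.inr i))
      ((fun i ↦ n (Sum.inl i)) + fun i ↦ n (Sum.inr i))
    refine ⟨k, ?_⟩
    rw [ContinuousAlternatingMap.compContinuousLinearMap_apply, latticeVec_prodPeriod, latticeVec_prodPeriod]
    have h : (⇑(ContinuousLinearMap.fst ℝ E E + ContinuousLinearMap.snd ℝ E E) ∘
        ![((latticeVec Φ fun i ↦ m (Sum.inl i), latticeVec Φ fun j ↦ m (Sum.inr j)) : E × E),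
          (latticeVec Φ fun i ↦ n (Sum.inl i), latticeVec Φ fun j ↦ n (Sum.inr j))]) =
        ![latticeVec Φ ((fun i ↦ m (Sum.inl i)) + fun i ↦ m (Sum.inr i)),
          latticeVec Φ ((fun i ↦ n (Sum.inl i)) + fun i ↦ n (Sum.inr i))] := by
      funext i
      fin_cases i
      · simp [latticeVec_add]
      · simp [latticeVec_add]
    rw [h, hk]

omit [Fintype ι] in
/-- An integer multiple of a Néron–Severi class is a Néron–Severi class. [cite: Lange2023AbelianVarietiesComplex, §1.3.1] -/
private theorem isNSForm_int_cast_smul₅₂ {κ : Type*} {V : Type*} [NormedAddCommGroup V] [NormedSpace ℂ V]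
    (Ψ : (κ → ℝ) ≃L[ℝ] V) {η : V [⋀^Fin 2]→L[ℝ] ℝ} (hη : IsNSForm Ψ η) (k : ℤ) : IsNSForm Ψ ((k : ℝ) • η) := by
  have h := AddSubgroup.zsmul_mem _ ((mem_neronSeveriGroup_iff Ψ).2 hη) k
  rw [← Int.cast_smul_eq_zsmul ℝ] at h
  exact (mem_neronSeveriGroup_iff Ψ).1 h

/-- **Bauer's class `B_m ∈ NS(X × X)`** for `M ∈ NS(X)` and `m ∈ ℕ` (an integer combination of
`pr₁^*M`, `pr₂^*M`, `μ^*M`). [cite: Bauer1998ConeOfCurves, §3 Prop. 3.1 (proof: "the line bundles `B_m = (1-m)L₁ + (m²-m)L₂ + mL₃`")] -/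
theorem isNSForm_bauerClass {M : E [⋀^Fin 2]→L[ℝ] ℝ} (hM : IsNSForm Φ M) (m : ℕ) :
    IsNSForm (prodPeriod Φ Φ)
      ((1 - (m : ℝ)) • M.compContinuousLinearMap (ContinuousLinearMap.fst ℝ E E) +
        ((m : ℝ) ^ 2 - m) • M.compContinuousLinearMap (ContinuousLinearMap.snd ℝ E E) +
        (m : ℝ) • M.compContinuousLinearMap (ContinuousLinearMap.fst ℝ E E + ContinuousLinearMap.snd ℝ E E)) := by
  classical
  have h1 : (1 - (m : ℝ)) = ((1 - m : ℤ) : ℝ) := by push_cast; ring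
  have h2 : ((m : ℝ) ^ 2 - m) = ((m ^ 2 - m : ℤ) : ℝ) := by push_cast; ring
  have h3 : (m : ℝ) = ((m : ℤ) : ℝ) := by push_cast; ring
  rw [h1, h2, h3]
  exact ((isNSForm_int_cast_smul₅₂ _ (isNSForm_comp_fst₅₂ Φ hM) _).add
    (isNSForm_int_cast_smul₅₂ _ (hM.comp_snd Φ) _)).add
    (isNSForm_int_cast_smul₅₂ _ (isNSForm_comp_fst_add_snd₅₂ Φ hM) _)

end BauerClasses

/-! ### §4 Prop. 3.1: no finitely generated cone of semi-positive forms contains all the `B_m`;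
`N(X × X)` is not finitely generated; `Nef(X × X)` is not rational polyhedral -/

section PropThreeOne

variable {E : Type*} [NormedAddCommGroup E] [NormedSpace ℂ E]

/-- **THE CORE OF PROP. 3.1.** For a positive definite `(1,1)`-form `M` on `E ≠ 0`, no finitely generated
convex cone `Σ ℝ≥0·gⱼ` of positive semi-definite `(1,1)`-forms on `E × E` contains all of Bauer's classes
`B_m`, `m ∈ ℕ`: `H_{B_m} = H_M(x + my)` vanishes on the graph `K_m`, so some non-zero generator vanishes on
`K_m` (§2); by pigeonhole one non-zero generator vanishes on two graphs, hence is `0` (§1).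
[cite: Bauer1998ConeOfCurves, §3 Prop. 3.1 (proof: the nef line bundles `B_m`, `m ≥ 1`)] -/
theorem not_forall_bauerClass_mem_span_nnreal [Nontrivial E] {M : E [⋀^Fin 2]→L[ℝ] ℝ}
    (hMpos : ∀ v : E, v ≠ 0 → 0 < M ![I • v, v])
    (G : Finset ((E × E) [⋀^Fin 2]→L[ℝ] ℝ))
    (hG : ∀ g ∈ G, (∀ u v : E × E, g ![I • u, I • v] = g ![u, v]) ∧ ∀ v : E × E, 0 ≤ g ![I • v, v]) :
    ¬ ∀ m : ℕ,
      ((1 - (m : ℝ)) • M.compContinuousLinearMap (ContinuousLinearMap.fst ℝ E E) +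
          ((m : ℝ) ^ 2 - m) • M.compContinuousLinearMap (ContinuousLinearMap.snd ℝ E E) +
          (m : ℝ) • M.compContinuousLinearMap (ContinuousLinearMap.fst ℝ E E + ContinuousLinearMap.snd ℝ E E)) ∈
        Submodule.span ℝ≥0 (G : Set ((E × E) [⋀^Fin 2]→L[ℝ] ℝ)) := by
  classical
  intro hall
  obtain ⟨x₀, hx₀⟩ := exists_ne (0 : E)
  -- for each `m`, a non-zero generator isotropic on `K_m`
  have hgen : ∀ m : ℕ, ∃ g ∈ G, g ≠ 0 ∧ ∀ y : E, g ![I • ((-((m : ℝ) • y), y) : E × E), (-((m : ℝ) • y), y)] = 0 := by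
    intro m
    have hB0 : ((1 - (m : ℝ)) • M.compContinuousLinearMap (ContinuousLinearMap.fst ℝ E E) +
          ((m : ℝ) ^ 2 - m) • M.compContinuousLinearMap (ContinuousLinearMap.snd ℝ E E) +
          (m : ℝ) • M.compContinuousLinearMap (ContinuousLinearMap.fst ℝ E E + ContinuousLinearMap.snd ℝ E E)) ≠ 0 := by
      intro h0
      have h := congrArg (fun θ : (E × E) [⋀^Fin 2]→L[ℝ] ℝ ↦ θ ![I • ((x₀, 0) : E × E), (x₀, 0)]) h0
      simp only [apply_I_smul_self_bauerClass, ContinuousAlternatingMap.coe_zero, Pi.zero_apply, smul_zero,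
        add_zero] at h
      exact (hMpos x₀ hx₀).ne' h
    obtain ⟨g, hg, hg0, hgW⟩ := exists_ne_zero_forall_apply_I_smul_self_eq_zero_of_mem_span_nnreal
      (fun g hg ↦ (hG g hg).2) (hall m) hB0
      (W := Set.range fun y : E ↦ ((-((m : ℝ) • y), y) : E × E)) (by
        rintro _ ⟨y, rfl⟩
        rw [apply_I_smul_self_bauerClass]
        simp only [neg_add_cancel, smul_zero]
        have h0 : (![(0 : E), 0] : Fin 2 → E) = 0 := by
          funext i
          fin_cases i <;> rfl
        rw [h0, ContinuousAlternatingMap.map_zero])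
    exact ⟨g, hg, hg0, fun y ↦ hgW _ ⟨y, rfl⟩⟩
  choose f hfG hf0 hfW using hgen
  -- pigeonhole on `m ∈ {0, …, |G|}`
  obtain ⟨m, -, m', -, hmm', hfmm'⟩ := Finset.exists_ne_map_eq_of_card_lt_of_maps_to
    (s := Finset.range (G.card + 1)) (t := G) (by rw [Finset.card_range]; exact Nat.lt_succ_self _)
    (f := f) fun m _ ↦ hfG m
  have hne : (m : ℝ) ≠ m' := by exact_mod_cast hmm'
  refine hf0 m (eq_zero_of_semipos_of_forall_graph_isotropic (hG _ (hfG m)).1 (hG _ (hfG m)).2 hne (hfW m) ?_)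
  rw [hfmm']
  exact hfW m'

variable {ι : Type*} [Fintype ι] [DecidableEq ι] (Φ : (ι → ℝ) ≃L[ℝ] E)

omit [DecidableEq ι] in
/-- **No finitely many semi-positive classes of `NS(X × X)` generate, even as a convex cone, all semi-positive
classes of `NS(X × X)`** (`X` an abelian variety `≠ 0`): Bauer's classes `B_m ∈ N(X × X)` escape every such
cone. [cite: Bauer1998ConeOfCurves, §3 Prop. 3.1 and §4 Thm. 4.2] -/
theorem IsAbelianVariety.not_exists_finset_forall_semipos_mem_span_nnreal_prod [Nontrivial E]
    (hX : IsAbelianVariety Φ) :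
    ¬ ∃ G : Finset ((E × E) [⋀^Fin 2]→L[ℝ] ℝ),
      (∀ g ∈ G, IsNSForm (prodPeriod Φ Φ) g ∧ ∀ v : E × E, 0 ≤ g ![I • v, v]) ∧
        ∀ η : (E × E) [⋀^Fin 2]→L[ℝ] ℝ, IsNSForm (prodPeriod Φ Φ) η → (∀ v : E × E, 0 ≤ η ![I • v, v]) →
          η ∈ Submodule.span ℝ≥0 (G : Set ((E × E) [⋀^Fin 2]→L[ℝ] ℝ)) := by
  rintro ⟨G, hG, hgen⟩
  obtain ⟨M, hM⟩ := hX
  refine not_forall_bauerClass_mem_span_nnreal hM.2.2 G (fun g hg ↦ ⟨(hG g hg).1.type_one_one, (hG g hg).2⟩)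
    fun m ↦ hgen _ (isNSForm_bauerClass Φ hM.isNSForm m) fun v ↦ ?_
  rw [apply_I_smul_self_bauerClass]
  exact apply_I_smul_self_nonneg_of_pos hM.2.2 _

omit [DecidableEq ι] in
/-- **Bauer 1998, Prop. 3.1 (for EVERY abelian variety `X ≠ 0`): the semigroup `N(X × X)` of effective
(= semi-positive) classes of `X × X` is not finitely generated.** As printed for `NS(X) ≅ ℤ` ("Let `X` be an
abelian variety with `NS(X) ≅ ℤ`. Then `N(X × X)` is not finitely generated"); the general case is the
repeated-factor exclusion of Thm. 4.2 (`X × X ~ ∏ Xᵢ^{2nᵢ}`). [cite: Bauer1998ConeOfCurves, §3 Prop. 3.1 and §4 Thm. 4.2 (proof: "if we had `nᵢ > 1` … impossible according to Proposition 3.1")] -/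
theorem IsAbelianVariety.not_exists_finset_addSubmonoidClosure_eq_prod [Nontrivial E] (hX : IsAbelianVariety Φ) :
    ¬ ∃ S : Finset ((E × E) [⋀^Fin 2]→L[ℝ] ℝ),
      (AddSubmonoid.closure (S : Set ((E × E) [⋀^Fin 2]→L[ℝ] ℝ)) : Set ((E × E) [⋀^Fin 2]→L[ℝ] ℝ)) =
        {η | IsNSForm (prodPeriod Φ Φ) η ∧ ∀ v : E × E, 0 ≤ η ![I • v, v]} := by
  rintro ⟨S, hS⟩
  refine hX.not_exists_finset_forall_semipos_mem_span_nnreal_prod Φ ⟨S, fun g hg ↦ ?_, fun η hη hpsd ↦ ?_⟩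
  · have h : g ∈ (AddSubmonoid.closure (S : Set ((E × E) [⋀^Fin 2]→L[ℝ] ℝ)) : Set ((E × E) [⋀^Fin 2]→L[ℝ] ℝ)) :=
      AddSubmonoid.subset_closure hg
    rw [hS] at h
    exact h
  · have h : η ∈ (AddSubmonoid.closure (S : Set ((E × E) [⋀^Fin 2]→L[ℝ] ℝ)) : Set ((E × E) [⋀^Fin 2]→L[ℝ] ℝ)) := by
      rw [hS]
      exact ⟨hη, hpsd⟩
    exact (AddSubmonoid.closure_le.2 (show (S : Set ((E × E) [⋀^Fin 2]→L[ℝ] ℝ)) ⊆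
      ((Submodule.span ℝ≥0 (S : Set ((E × E) [⋀^Fin 2]→L[ℝ] ℝ))).toAddSubmonoid :
        Set ((E × E) [⋀^Fin 2]→L[ℝ] ℝ)) from Submodule.subset_span)) h

omit [DecidableEq ι] in
/-- **The nef cone `Nef(X × X) = {θ ∈ NS_ℝ(X × X) | H_θ ≥ 0}` of the self-product of an abelian variety
`X ≠ 0` is NOT a rational polyhedral cone**: it is not the `ℝ≥0`-span of finitely many integral classes (the
Theorem's (ib) fails for `X × X`, as (ii) does). [cite: Bauer1998ConeOfCurves, §1 Theorem ((ib) ⟺ (ii)) and §3 Prop. 3.1] -/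
theorem IsAbelianVariety.not_exists_finset_span_nnreal_eq_prod [Nontrivial E] (hX : IsAbelianVariety Φ) :
    ¬ ∃ S : Finset ((E × E) [⋀^Fin 2]→L[ℝ] ℝ), (∀ η ∈ S, IsNSForm (prodPeriod Φ Φ) η) ∧
      (Submodule.span ℝ≥0 (S : Set ((E × E) [⋀^Fin 2]→L[ℝ] ℝ)) : Set ((E × E) [⋀^Fin 2]→L[ℝ] ℝ)) =
        {θ | θ ∈ Submodule.span ℝ {η : (E × E) [⋀^Fin 2]→L[ℝ] ℝ | IsNSForm (prodPeriod Φ Φ) η} ∧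
          ∀ v : E × E, 0 ≤ θ ![I • v, v]} := by
  rintro ⟨S, hSNS, hS⟩
  refine hX.not_exists_finset_forall_semipos_mem_span_nnreal_prod Φ ⟨S, fun g hg ↦ ⟨hSNS g hg, ?_⟩, fun η hη hpsd ↦ ?_⟩
  · have h : g ∈ (Submodule.span ℝ≥0 (S : Set ((E × E) [⋀^Fin 2]→L[ℝ] ℝ)) : Set ((E × E) [⋀^Fin 2]→L[ℝ] ℝ)) :=
      Submodule.subset_span hg
    rw [hS] at h
    exact h.2
  · have h : η ∈ (Submodule.span ℝ≥0 (S : Set ((E × E) [⋀^Fin 2]→L[ℝ] ℝ)) : Set ((E × E) [⋀^Fin 2]→L[ℝ] ℝ)) := by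
      rw [hS]
      exact ⟨Submodule.subset_span hη, hpsd⟩
    exact h

/-- **Thm. 4.2, the exclusion of repeated factors, with Lemma 4.1: no complex torus isogenous to the
self-product `X × X` of an abelian variety `X ≠ 0` has a finitely generated semigroup of effective classes.**
[cite: Bauer1998ConeOfCurves, §4 Thm. 4.2 (proof) and Lemma 4.1] -/
theorem IsIsogenous.not_exists_finset_addSubmonoidClosure_eq_of_prod [Nontrivial E] {ι' : Type*} [Fintype ι']
    [DecidableEq ι'] {E' : Type*} [NormedAddCommGroup E'] [NormedSpace ℂ E'] {Ψ : (ι' → ℝ) ≃L[ℝ] E'}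
    (h : IsIsogenous Ψ (prodPeriod Φ Φ)) (hX : IsAbelianVariety Φ) :
    ¬ ∃ S : Finset (E' [⋀^Fin 2]→L[ℝ] ℝ),
      (AddSubmonoid.closure (S : Set (E' [⋀^Fin 2]→L[ℝ] ℝ)) : Set (E' [⋀^Fin 2]→L[ℝ] ℝ)) =
        {η | IsNSForm Ψ η ∧ ∀ v : E', 0 ≤ η ![I • v, v]} := by
  rw [h.exists_finset_addSubmonoidClosure_eq_iff Ψ (prodPeriod Φ Φ)]
  exact hX.not_exists_finset_addSubmonoidClosure_eq_prod Φ

end PropThreeOne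

end ComplexTorus

end Literature.Geometry.Kaehler

end
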